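import Literature.AlgebraicGeometry.ComplexMultiplication.CyclotomicFermatCMTypesBadCharacterCriterion
import Literature.AlgebraicGeometry.ComplexMultiplication.CyclotomicFermatCMTypesTwoPrimeLevelMaximum
import HarnessLib

/-!
# Koblitz–Rohrlich, REMARK 1 "`3/20` is the maximum for `s(N)` (attained only when `N = 55`)" at levels with FOUR or FIVE prime factors:
# `40·#S₀(N) < 3·φ(N)` (`s(N) < 3/20`) — Case 3's printed bounds sharpened by one unit

Layer `Literature/AlgebraicGeometry/ComplexMultiplication`, namespace `…ComplexMultiplication.CyclotomicFermatCMType`; sequel of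
`CyclotomicFermatCMTypesBadCharacterCriterion` (K–R's method as a criterion; Table 1; the per-prime bounds `(ℓ − 1)·d ≥ 25` (`m = 4`) and
`≥ 31` (`m = 5`) that give the Proposition's `1/6`) and `CyclotomicFermatCMTypesTwoPrimeLevelMaximum` (`s(55) = 3/20`, `ω(N) ≤ 2`).
THEOREMS ONLY (no definition, no named fact, no `sorry`).

THE SOURCE.  N. Koblitz, D. Rohrlich, *Simple factors in the Jacobian of a Fermat curve*, Canad. J. Math. **30** (1978) 1183–1205, §2, proof
of the Proposition (pp. 1191–1192): "Case 3. `m = 4`.  If `pᵢ = 5` or `7`, then `ordᵢ ≥ 9` by Table 1.  This, together with (1) and (2),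
gives: `1/((p₁ − 1)ord₁) ≤ 1/(4·9)`, `1/((p₂ − 1)ord₂) ≤ 1/(10·3)`, `1/((p₃ − 1)ord₃) ≤ 1/(10·2)`, `1/((p₄ − 1)ord₄) ≤ 1/(12·2)` and so
`Σᵢ 1/((pᵢ − 1)ordᵢ) < 1/6`.  Case 4. `5 ≤ m ≤ 9`. From Table 1, if `pᵢ = 5, 7, 11`, then `ordᵢ ≥ 10, 10, 6`, respectively …" and REMARK 1
(p. 1192): "It is clear from the above proof that `3/20` is the maximum for `s(N)` (attained only when `N = 55`)".

WHAT IS PROVED, AND A CAVEAT ON THE PRINTED NUMBERS.  Case 3's four printed bounds sum to `1/36 + 1/30 + 1/20 + 1/24 = 55/360`, which is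
`< 1/6 = 60/360` (the Proposition) but EXCEEDS `3/20 = 54/360`: Remark 1's "clear from the above proof" needs one more word at `m = 4`.  The
word: when THREE distinct primes `≥ 5` divide `ℓᵈ − 1`, in fact `(ℓ − 1)·d ≥ 28` for every prime `ℓ ≥ 5` (`ℓ = 5`: `d ≥ 7`; `ℓ = 7`: `d ≥ 5`;
`ℓ ≥ 11`: `ℓᵈ ≥ 386`, so `d = 1 ⟹ ℓ ≥ 387`, `d = 2 ⟹ ℓ ≥ 20`, `d ≥ 3 ⟹ ≥ 30`) — the sibling's proof of `≥ 25` already shows this —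
whence `s(N) ≤ 4/28 = 1/7 < 3/20`; and when FOUR distinct primes `≥ 5` divide `ℓᵈ − 1`, `(ℓ − 1)·d ≥ 36` (`ℓ = 5`: `d ≥ 9`, using the
Table 1 entry `5⁸ − 1 = 2⁵·3·13·313`; `ℓ = 7`: `d ≥ 6`; `ℓ = 11`: `d ≥ 4`; `ℓ ≥ 13`: `d ≥ 3` or `ℓ` large), whence `s(N) ≤ 5/36 < 3/20` at
`m = 5`.

* §1 (any `N`): the weighted form of the sibling's criterion — if `c ≤ (ℓ − 1)·d` for every prime `ℓ ∣ N` and every `d ≥ 1` with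
  `N_ℓ ∣ ℓᵈ − 1`, then `2c·Σ_ℓ T_ℓ ≤ ω(N)·φ(N)` (`two_mul_mul_sum_card_le_of_forall_le`), so `40·Σ_ℓ T_ℓ < 3·φ(N)` as soon as
  `40·ω(N) < 6c` (`forty_mul_sum_card_lt_of_forall_le`).
* §2 `ω(N) = 4`: `twentyeight_le_sub_one_mul_of_three_primes_dvd`; **`forty_mul_card_bad_lt_four_primes`** (`40·#S₀(N) < 3·φ(N)`),
  `s_lt_three_div_twenty_four_primes`.
* §3 `ω(N) = 5`: the Table 1 entry `not_three_primes_dvd_pow_sub_one_of_le_eight` (`5ᵈ − 1`, `d ≤ 8`), `thirtysix_le_sub_one_mul_of_four_primes_dvd`;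
  **`forty_mul_card_bad_lt_five_primes`**, `s_lt_three_div_twenty_five_primes`; §4 `s_lt_s_fiftyFive_fourFivePrimes`.

With the siblings (`ω(N) ≤ 3`): **at every level prime to `6` with `ω(N) ≤ 5`, `s(N) ≤ 3/20` with equality iff `N = 55`.**

## Honest column / NOT here

* The bounds `28`, `36` and the bookkeeping are ours; K–R print `36, 30, 20, 24` (Case 3) and order bounds (Case 4) aimed at `1/6`.
* `ω(N) ≥ 6` (K–R's Cases 4–5 for `m ≥ 6` with the constant `3/20`) is NOT typed; nor "`lim s(N)`"-type statements.
* Private: copies of the siblings' `dvd_pow_orderOf_sub_one`, `sub_one_mul_totient_ordCompl_le`, the `2ⁱ3ʲsᵏtˡ` divisor lemmas,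
  `le_mul_mul_of_three_primes` (`≥ 385`), and the prime-factor extraction.

## References

* [KoblitzRohrlich1978] N. Koblitz, D. Rohrlich, Canad. J. Math. 30 (1978) 1183–1205: §2 Proposition, Table 1, Cases 3–4 (pp. 1190–1192),
  Remark 1 (p. 1192).

## Provenance

Cell `pub-hodgecm2` (COR-CM), literature seat `lit-deligne-3` gen 35 (claim KR78-MAXIMUM-45; count-neutral, own lane).
-/

noncomputable section

open NumberField

namespace Literature.AlgebraicGeometry.ComplexMultiplication

open Literature.NumberTheory.ComplexMultiplication
open Literature.NumberTheory.LFunctions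

namespace CyclotomicFermatCMType

/-! ## §1 The weighted criterion: `c ≤ (ℓ − 1)·d` for all `ℓ ∣ N` gives `2c·Σ T_ℓ ≤ ω(N)·φ(N)` -/

section Weighted

variable {N : ℕ}

/-- `M ∣ m^{ord(m)} − 1` for `m` prime to `M` (private copy of the siblings'). [folklore] -/
private theorem dvd_pow_orderOf_sub_one₅ {M : ℕ} [NeZero M] {m : ℕ} (hm : m.Coprime M) :
    M ∣ m ^ orderOf (ZMod.unitOfCoprime m hm) - 1 := by
  have hu : ((m : ZMod M)) ^ orderOf (ZMod.unitOfCoprime m hm) = 1 := by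
    rw [← ZMod.coe_unitOfCoprime m hm, ← Units.val_pow_eq_pow_val, pow_orderOf_eq_one, Units.val_one]
  rcases Nat.eq_zero_or_pos m with h0 | hpos
  · subst h0
    have hM : M = 1 := (Nat.coprime_zero_left _).1 hm
    subst hM
    exact one_dvd _
  have h1 : 1 ≤ m ^ orderOf (ZMod.unitOfCoprime m hm) := Nat.one_le_pow _ _ hpos
  have h : ((m ^ orderOf (ZMod.unitOfCoprime m hm) - 1 : ℕ) : ZMod M) = 0 := by
    rw [Nat.cast_sub h1, Nat.cast_pow, Nat.cast_one, hu, sub_self]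
  exact (ZMod.natCast_eq_zero_iff _ _).1 h

/-- `φ(N) ≥ (ℓ − 1)·φ(N_ℓ)` for a prime `ℓ ∣ N` (private copy of the sibling's). [folklore] -/
private theorem sub_one_mul_totient_ordCompl_le' {ℓ : ℕ} (hN : N ≠ 0) (hℓ : ℓ ∈ N.primeFactors) :
    (ℓ - 1) * (ordCompl[ℓ] N).totient ≤ N.totient := by
  have hℓp : ℓ.Prime := Nat.prime_of_mem_primeFactors hℓ
  have hk : 0 < N.factorization ℓ := Nat.Prime.factorization_pos_of_dvd hℓp hN (Nat.dvd_of_mem_primeFactors hℓ)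
  have hcop : (ordProj[ℓ] N).Coprime (ordCompl[ℓ] N) := (Nat.coprime_ordCompl hℓp hN).pow_left _
  conv_rhs => rw [← Nat.ordProj_mul_ordCompl_eq_self N ℓ]
  rw [Nat.totient_mul hcop, Nat.totient_prime_pow hℓp hk]
  refine Nat.mul_le_mul_right _ ?_
  calc ℓ - 1 = 1 * (ℓ - 1) := (one_mul _).symm
    _ ≤ ℓ ^ (N.factorization ℓ - 1) * (ℓ - 1) := Nat.mul_le_mul_right _ (Nat.one_le_pow _ _ hℓp.pos)

/-- **The weighted criterion**: if `c ≤ (ℓ − 1)·d` for every prime `ℓ ∣ N` and every `d ≥ 1` with `N_ℓ ∣ ℓᵈ − 1` (in particular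
`d = ord_{N_ℓ}(ℓ)`), then `2c·Σ_{ℓ ∣ N} #{ψ mod N_ℓ odd : ψ(ℓ) = 1} ≤ ω(N)·φ(N)` (each summand: `2·ord·T_ℓ ≤ φ(N_ℓ)`, `(ℓ − 1)φ(N_ℓ) ≤ φ(N)`;
K–R's "`s(N) ≤ Σᵢ 1/((pᵢ − 1)ordᵢ)`" with a uniform bound). [cite: KoblitzRohrlich1978, §2 proof of the Proposition (pp. 1190–1192)] -/
theorem two_mul_mul_sum_card_le_of_forall_le (hN : N ≠ 0) {c : ℕ}
    (h : ∀ ℓ ∈ N.primeFactors, ∀ d : ℕ, 0 < d → ordCompl[ℓ] N ∣ ℓ ^ d - 1 → c ≤ (ℓ - 1) * d) :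
    2 * c * ∑ ℓ ∈ N.primeFactors,
        Nat.card {ψ : DirichletCharacter ℂ (ordCompl[ℓ] N) // ψ.Odd ∧ ψ (ℓ : ZMod (ordCompl[ℓ] N)) = 1} ≤
      N.primeFactors.card * N.totient := by
  haveI hM : ∀ ℓ, NeZero (ordCompl[ℓ] N) := fun ℓ => ⟨(Nat.ordCompl_pos ℓ hN).ne'⟩
  have hper : ∀ ℓ ∈ N.primeFactors,
      2 * c * Nat.card {ψ : DirichletCharacter ℂ (ordCompl[ℓ] N) // ψ.Odd ∧ ψ (ℓ : ZMod (ordCompl[ℓ] N)) = 1} ≤ N.totient := by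
    intro ℓ hℓ
    have hℓp : ℓ.Prime := Nat.prime_of_mem_primeFactors hℓ
    have hcop : ℓ.Coprime (ordCompl[ℓ] N) := Nat.coprime_ordCompl hℓp hN
    have hT : Nat.card {ψ : DirichletCharacter ℂ (ordCompl[ℓ] N) // ψ.Odd ∧ ψ (ℓ : ZMod (ordCompl[ℓ] N)) = 1} =
        Nat.card {ψ : DirichletCharacter ℂ (ordCompl[ℓ] N) // ψ.Odd ∧ ψ (ZMod.unitOfCoprime ℓ hcop) = 1} := by
      refine Nat.card_congr (Equiv.subtypeEquivRight fun ψ => ?_)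
      rw [ZMod.coe_unitOfCoprime]
    rw [hT]
    set T := Nat.card {ψ : DirichletCharacter ℂ (ordCompl[ℓ] N) // ψ.Odd ∧ ψ (ZMod.unitOfCoprime ℓ hcop) = 1}
    set d := orderOf (ZMod.unitOfCoprime ℓ hcop)
    have h2 : 2 * d * T ≤ (ordCompl[ℓ] N).totient := two_mul_orderOf_mul_card_odd_apply_eq_one_le _
    have hcd : c ≤ (ℓ - 1) * d := h ℓ hℓ d (orderOf_pos _) (dvd_pow_orderOf_sub_one₅ hcop)
    calc 2 * c * T ≤ 2 * ((ℓ - 1) * d) * T := Nat.mul_le_mul_right _ (Nat.mul_le_mul_left 2 hcd)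
      _ = (ℓ - 1) * (2 * d * T) := by ring
      _ ≤ (ℓ - 1) * (ordCompl[ℓ] N).totient := Nat.mul_le_mul_left _ h2
      _ ≤ N.totient := sub_one_mul_totient_ordCompl_le' hN hℓ
  rw [Finset.mul_sum]
  have := Finset.sum_le_sum hper
  rwa [Finset.sum_const, smul_eq_mul] at this

/-- **`40·Σ T_ℓ < 3·φ(N)` from the weighted criterion** whenever `40·ω(N) < 6c` (i.e. `ω(N)/c < 3/20`).
[cite: KoblitzRohrlich1978, §2 proof of the Proposition (pp. 1190–1192) and Remark 1 (p. 1192)] -/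
theorem forty_mul_sum_card_lt_of_forall_le (hN : N ≠ 0) {c : ℕ} (hc : 40 * N.primeFactors.card < 6 * c)
    (h : ∀ ℓ ∈ N.primeFactors, ∀ d : ℕ, 0 < d → ordCompl[ℓ] N ∣ ℓ ^ d - 1 → c ≤ (ℓ - 1) * d) :
    40 * ∑ ℓ ∈ N.primeFactors,
        Nat.card {ψ : DirichletCharacter ℂ (ordCompl[ℓ] N) // ψ.Odd ∧ ψ (ℓ : ZMod (ordCompl[ℓ] N)) = 1} < 3 * N.totient := by
  have hsum := two_mul_mul_sum_card_le_of_forall_le hN h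
  have hφ : 0 < N.totient := Nat.totient_pos.2 (Nat.pos_of_ne_zero hN)
  set S := ∑ ℓ ∈ N.primeFactors,
      Nat.card {ψ : DirichletCharacter ℂ (ordCompl[ℓ] N) // ψ.Odd ∧ ψ (ℓ : ZMod (ordCompl[ℓ] N)) = 1}
  set m := N.primeFactors.card
  have h1 : 2 * c * (40 * S) ≤ 40 * (m * N.totient) := by
    calc 2 * c * (40 * S) = 40 * (2 * c * S) := by ring
      _ ≤ 40 * (m * N.totient) := Nat.mul_le_mul_left _ hsum
  have h2 : 40 * (m * N.totient) < 2 * c * (3 * N.totient) := by nlinarith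
  exact Nat.lt_of_mul_lt_mul_left (lt_of_le_of_lt h1 h2)

end Weighted

/-! ## §2 Divisor lemmas (private copies) and the Table 1 entry `5⁸ − 1 = 2⁵·3·13·313` -/

section Table

/-- A prime `≥ 5` does not divide `2ⁱ·3ʲ` (private copy). [folklore] -/
private theorem not_dvd_two_pow_mul_three_pow₅ {q : ℕ} (hq : q.Prime) (h5 : 5 ≤ q) (i j : ℕ) : ¬q ∣ 2 ^ i * 3 ^ j := by
  intro h
  rcases (Nat.Prime.dvd_mul hq).1 h with h2 | h3
  · have := (Nat.prime_dvd_prime_iff_eq hq Nat.prime_two).1 (hq.dvd_of_dvd_pow h2)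
    omega
  · have := (Nat.prime_dvd_prime_iff_eq hq Nat.prime_three).1 (hq.dvd_of_dvd_pow h3)
    omega

/-- A prime `q ≥ 5` dividing `2ⁱ·3ʲ·sᵏ·tˡ` (`s, t` prime) is `s` or `t` (private copy). [folklore] -/
private theorem eq_or_eq_of_dvd₅ {q s t i j k l : ℕ} (hq : q.Prime) (h5 : 5 ≤ q) (hs : s.Prime) (ht : t.Prime)
    (h : q ∣ 2 ^ i * 3 ^ j * s ^ k * t ^ l) : q = s ∨ q = t := by
  rcases (Nat.Prime.dvd_mul hq).1 h with h1 | h1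
  · rcases (Nat.Prime.dvd_mul hq).1 h1 with h2 | h2
    · exact absurd h2 (not_dvd_two_pow_mul_three_pow₅ hq h5 i j)
    · exact Or.inl ((Nat.prime_dvd_prime_iff_eq hq hs).1 (hq.dvd_of_dvd_pow h2))
  · exact Or.inr ((Nat.prime_dvd_prime_iff_eq hq ht).1 (hq.dvd_of_dvd_pow h1))

/-- Three distinct primes `≥ 5` cannot all divide `2ⁱ·3ʲ·sᵏ·tˡ` (private copy). [folklore] -/
private theorem three_primes_not_dvd₅ {X s t i j k l q₁ q₂ q₃ : ℕ} (hX : X = 2 ^ i * 3 ^ j * s ^ k * t ^ l) (hs : s.Prime)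
    (ht : t.Prime) (h₁ : q₁.Prime) (h₂ : q₂.Prime) (h₃ : q₃.Prime) (h₁5 : 5 ≤ q₁) (h₂5 : 5 ≤ q₂) (h₃5 : 5 ≤ q₃)
    (h₁₂ : q₁ ≠ q₂) (h₁₃ : q₁ ≠ q₃) (h₂₃ : q₂ ≠ q₃) (d₁ : q₁ ∣ X) (d₂ : q₂ ∣ X) (d₃ : q₃ ∣ X) : False := by
  subst hX
  rcases eq_or_eq_of_dvd₅ h₁ h₁5 hs ht d₁ with rfl | rfl <;>
    rcases eq_or_eq_of_dvd₅ h₂ h₂5 hs ht d₂ with e₂ | e₂ <;>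
      rcases eq_or_eq_of_dvd₅ h₃ h₃5 hs ht d₃ with e₃ | e₃ <;> omega

/-- **TABLE 1, the column `p = 5` through `m = 8`**: for `d ≤ 8`, `5ᵈ − 1` is not divisible by three distinct primes `≥ 5` (the sibling's
`d ≤ 7` and the entry `5⁸ − 1 = 390624 = 2⁵·3·13·313`, primes `13, 313`). [cite: KoblitzRohrlich1978, §2 Table 1 (p. 1190)] -/
theorem not_three_primes_dvd_pow_sub_one_of_le_eight {d q₁ q₂ q₃ : ℕ} (hd8 : d ≤ 8) (hd : 0 < d)
    (h₁ : q₁.Prime) (h₂ : q₂.Prime) (h₃ : q₃.Prime) (h₁5 : 5 ≤ q₁) (h₂5 : 5 ≤ q₂) (h₃5 : 5 ≤ q₃)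
    (h₁₂ : q₁ ≠ q₂) (h₁₃ : q₁ ≠ q₃) (h₂₃ : q₂ ≠ q₃) (d₁ : q₁ ∣ 5 ^ d - 1) (d₂ : q₂ ∣ 5 ^ d - 1) (d₃ : q₃ ∣ 5 ^ d - 1) :
    False := by
  rcases Nat.lt_or_ge d 8 with hlt | hge
  · exact not_three_primes_dvd_pow_sub_one' (Or.inl ⟨rfl, by omega⟩) hd h₁ h₂ h₃ h₁5 h₂5 h₃5 h₁₂ h₁₃ h₂₃ d₁ d₂ d₃
  · have hd' : d = 8 := by omega
    subst hd'
    exact three_primes_not_dvd₅ (X := 5 ^ 8 - 1) (i := 5) (j := 1) (s := 13) (k := 1) (t := 313) (l := 1) (by norm_num)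
      (by norm_num) (by norm_num) h₁ h₂ h₃ h₁5 h₂5 h₃5 h₁₂ h₁₃ h₂₃ d₁ d₂ d₃

/-- The product of three distinct primes `≥ 5` is at least `5·7·11 = 385` (private copy of the sibling's). [folklore] -/
private theorem le_mul_mul_of_three_primes₅ {q₁ q₂ q₃ : ℕ} (h₁ : q₁.Prime) (h₂ : q₂.Prime) (h₃ : q₃.Prime) (h₁5 : 5 ≤ q₁)
    (h₂5 : 5 ≤ q₂) (h₃5 : 5 ≤ q₃) (h₁₂ : q₁ ≠ q₂) (h₁₃ : q₁ ≠ q₃) (h₂₃ : q₂ ≠ q₃) : 385 ≤ q₁ * q₂ * q₃ := by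
  have small : ∀ {q : ℕ}, q.Prime → 5 ≤ q → q < 11 → q = 5 ∨ q = 7 := by
    intro q hq h5 h11
    interval_cases q
    · exact Or.inl rfl
    · exact absurd hq (by decide)
    · exact Or.inr rfl
    · exact absurd hq (by decide)
    · exact absurd hq (by decide)
    · exact absurd hq (by decide)
  have h6 : ∀ {q : ℕ}, q.Prime → 5 ≤ q → q ≠ 5 → 7 ≤ q := by
    intro q hq h5 hne
    have : q ≠ 6 := fun h => by rw [h] at hq; exact absurd hq (by decide)
    omega
  have pair : ∀ {x y : ℕ}, x.Prime → y.Prime → 5 ≤ x → 5 ≤ y → x ≠ y → 35 ≤ x * y := by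
    intro x y hx hy hx5 hy5 hxy
    by_cases hx' : x = 5
    · subst hx'
      have := h6 hy hy5 (Ne.symm hxy)
      nlinarith
    · have := h6 hx hx5 hx'
      nlinarith
  by_cases g₁ : 11 ≤ q₁
  · have := pair h₂ h₃ h₂5 h₃5 h₂₃
    nlinarith
  by_cases g₂ : 11 ≤ q₂
  · have := pair h₁ h₃ h₁5 h₃5 h₁₃
    nlinarith
  by_cases g₃ : 11 ≤ q₃
  · have := pair h₁ h₂ h₁5 h₂5 h₁₂
    nlinarith
  exfalso
  rcases small h₁ h₁5 (by omega) with rfl | rfl <;> rcases small h₂ h₂5 (by omega) with rfl | rfl <;>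
    rcases small h₃ h₃5 (by omega) with e | e <;> omega

/-- **`(ℓ − 1)·d ≥ 28` when three distinct primes `≥ 5` divide `ℓᵈ − 1`** (`ℓ` prime `≥ 5`, `d ≥ 1`): the sibling's `≥ 25` sharpened to
what its proof gives (`ℓ = 5`: `d ≥ 7`; `ℓ = 7`: `d ≥ 5`; `ℓ ≥ 11`: `ℓᵈ ≥ 386`) — the unit that turns Case 3's `55/360` into `< 3/20`.
[cite: KoblitzRohrlich1978, §2 Proposition, Case 3 (pp. 1191–1192) and Remark 1 (p. 1192)] -/
theorem twentyeight_le_sub_one_mul_of_three_primes_dvd {ℓ d q₁ q₂ q₃ : ℕ} (hℓ : ℓ.Prime) (hℓ5 : 5 ≤ ℓ) (hd : 0 < d)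
    (h₁ : q₁.Prime) (h₂ : q₂.Prime) (h₃ : q₃.Prime) (h₁5 : 5 ≤ q₁) (h₂5 : 5 ≤ q₂) (h₃5 : 5 ≤ q₃)
    (h₁₂ : q₁ ≠ q₂) (h₁₃ : q₁ ≠ q₃) (h₂₃ : q₂ ≠ q₃) (d₁ : q₁ ∣ ℓ ^ d - 1) (d₂ : q₂ ∣ ℓ ^ d - 1) (d₃ : q₃ ∣ ℓ ^ d - 1) :
    28 ≤ (ℓ - 1) * d := by
  have hprod : q₁ * q₂ * q₃ ∣ ℓ ^ d - 1 :=
    Nat.Coprime.mul_dvd_of_dvd_of_dvd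
      (Nat.Coprime.mul_left ((Nat.coprime_primes h₁ h₃).2 h₁₃) ((Nat.coprime_primes h₂ h₃).2 h₂₃))
      (Nat.Coprime.mul_dvd_of_dvd_of_dvd ((Nat.coprime_primes h₁ h₂).2 h₁₂) d₁ d₂) d₃
  have h385 := le_mul_mul_of_three_primes₅ h₁ h₂ h₃ h₁5 h₂5 h₃5 h₁₂ h₁₃ h₂₃
  have hpos : 0 < ℓ ^ d - 1 := by
    have : ℓ ^ 1 ≤ ℓ ^ d := Nat.pow_le_pow_right hℓ.pos hd
    rw [pow_one] at this
    omega
  have hle : q₁ * q₂ * q₃ ≤ ℓ ^ d - 1 := Nat.le_of_dvd hpos hprod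
  have h386 : 386 ≤ ℓ ^ d := by omega
  by_cases h11 : 11 ≤ ℓ
  · rcases Nat.lt_or_ge d 3 with hd3 | hd3
    · have hd12 : d = 1 ∨ d = 2 := by omega
      rcases hd12 with rfl | rfl
      · rw [pow_one] at h386
        omega
      · have h20 : 20 ≤ ℓ := by nlinarith
        omega
    · calc 28 ≤ 10 * 3 := by norm_num
        _ ≤ (ℓ - 1) * d := Nat.mul_le_mul (by omega) hd3
  · have hℓ57 : ℓ = 5 ∨ ℓ = 7 := by
      interval_cases ℓ
      · exact Or.inl rfl
      · exact absurd hℓ (by decide)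
      · exact Or.inr rfl
      · exact absurd hℓ (by decide)
      · exact absurd hℓ (by decide)
      · exact absurd hℓ (by decide)
    rcases hℓ57 with rfl | rfl
    · have hd7 : 7 ≤ d := by
        by_contra hlt
        exact not_three_primes_dvd_pow_sub_one (Or.inl ⟨rfl, by omega⟩) hd h₁ h₂ h₃ h₁5 h₂5 h₃5 h₁₂ h₁₃ h₂₃ d₁ d₂ d₃
      omega
    · have hd5 : 5 ≤ d := by
        by_contra hlt
        exact not_three_primes_dvd_pow_sub_one (Or.inr ⟨rfl, by omega⟩) hd h₁ h₂ h₃ h₁5 h₂5 h₃5 h₁₂ h₁₃ h₂₃ d₁ d₂ d₃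
      omega

/-- **`(ℓ − 1)·d ≥ 36` when four distinct primes `≥ 5` divide `ℓᵈ − 1`** (`ℓ` prime `≥ 5`, `d ≥ 1`): `ℓ = 5`: `d ≥ 9` (Table 1 through
`5⁸ − 1`); `ℓ = 7`: `d ≥ 6`; `ℓ = 11`: `d ≥ 4` (`11³ = 1331 < 1926`); `ℓ ≥ 13`: `d ≥ 3`, or `d ≤ 2` with `ℓᵈ ≥ 1926`.
[cite: KoblitzRohrlich1978, §2 Proposition, Case 4 (pp. 1191–1192), Table 1 (p. 1190) and Remark 1 (p. 1192)] -/
theorem thirtysix_le_sub_one_mul_of_four_primes_dvd {ℓ d q₁ q₂ q₃ q₄ : ℕ} (hℓ : ℓ.Prime) (hℓ5 : 5 ≤ ℓ) (hd : 0 < d)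
    (h₁ : q₁.Prime) (h₂ : q₂.Prime) (h₃ : q₃.Prime) (h₄ : q₄.Prime) (h₁5 : 5 ≤ q₁) (h₂5 : 5 ≤ q₂) (h₃5 : 5 ≤ q₃) (h₄5 : 5 ≤ q₄)
    (h₁₂ : q₁ ≠ q₂) (h₁₃ : q₁ ≠ q₃) (h₂₃ : q₂ ≠ q₃) (h₁₄ : q₁ ≠ q₄) (h₂₄ : q₂ ≠ q₄) (h₃₄ : q₃ ≠ q₄)
    (d₁ : q₁ ∣ ℓ ^ d - 1) (d₂ : q₂ ∣ ℓ ^ d - 1) (d₃ : q₃ ∣ ℓ ^ d - 1) (d₄ : q₄ ∣ ℓ ^ d - 1) :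
    36 ≤ (ℓ - 1) * d := by
  have hprod3 : q₁ * q₂ * q₃ ∣ ℓ ^ d - 1 :=
    Nat.Coprime.mul_dvd_of_dvd_of_dvd
      (Nat.Coprime.mul_left ((Nat.coprime_primes h₁ h₃).2 h₁₃) ((Nat.coprime_primes h₂ h₃).2 h₂₃))
      (Nat.Coprime.mul_dvd_of_dvd_of_dvd ((Nat.coprime_primes h₁ h₂).2 h₁₂) d₁ d₂) d₃
  have hprod : q₁ * q₂ * q₃ * q₄ ∣ ℓ ^ d - 1 :=
    Nat.Coprime.mul_dvd_of_dvd_of_dvd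
      (Nat.Coprime.mul_left (Nat.Coprime.mul_left ((Nat.coprime_primes h₁ h₄).2 h₁₄) ((Nat.coprime_primes h₂ h₄).2 h₂₄))
        ((Nat.coprime_primes h₃ h₄).2 h₃₄)) hprod3 d₄
  have h385 := le_mul_mul_of_three_primes₅ h₁ h₂ h₃ h₁5 h₂5 h₃5 h₁₂ h₁₃ h₂₃
  have h1925 : 1925 ≤ q₁ * q₂ * q₃ * q₄ := by nlinarith
  have hpos : 0 < ℓ ^ d - 1 := by
    have : ℓ ^ 1 ≤ ℓ ^ d := Nat.pow_le_pow_right hℓ.pos hd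
    rw [pow_one] at this
    omega
  have hle : q₁ * q₂ * q₃ * q₄ ≤ ℓ ^ d - 1 := Nat.le_of_dvd hpos hprod
  have h1926 : 1926 ≤ ℓ ^ d := by omega
  by_cases h11 : 11 ≤ ℓ
  · rcases Nat.lt_or_ge d 3 with hd3 | hd3
    · have hd12 : d = 1 ∨ d = 2 := by omega
      rcases hd12 with rfl | rfl
      · rw [pow_one] at h1926
        omega
      · have h44 : 44 ≤ ℓ := by nlinarith
        omega
    · by_cases h13 : 13 ≤ ℓ
      · calc 36 ≤ 12 * 3 := by norm_num
          _ ≤ (ℓ - 1) * d := Nat.mul_le_mul (by omega) hd3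
      · have hℓ11 : ℓ = 11 := by
          have : ℓ ≠ 12 := fun h => by rw [h] at hℓ; exact absurd hℓ (by decide)
          omega
        subst hℓ11
        have hd4 : 4 ≤ d := by
          by_contra hlt
          have hd3' : d = 3 := by omega
          rw [hd3'] at h1926
          norm_num at h1926
        omega
  · have hℓ57 : ℓ = 5 ∨ ℓ = 7 := by
      interval_cases ℓ
      · exact Or.inl rfl
      · exact absurd hℓ (by decide)
      · exact Or.inr rfl
      · exact absurd hℓ (by decide)
      · exact absurd hℓ (by decide)
      · exact absurd hℓ (by decide)
    rcases hℓ57 with rfl | rfl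
    · have hd9 : 9 ≤ d := by
        by_contra hlt
        exact not_three_primes_dvd_pow_sub_one_of_le_eight (by omega) hd h₁ h₂ h₃ h₁5 h₂5 h₃5 h₁₂ h₁₃ h₂₃ d₁ d₂ d₃
      omega
    · have hd6 : 6 ≤ d := by
        by_contra hlt
        exact not_three_primes_dvd_pow_sub_one' (Or.inr ⟨rfl, by omega⟩) hd h₁ h₂ h₃ h₁5 h₂5 h₃5 h₁₂ h₁₃ h₂₃ d₁ d₂ d₃
      omega

end Table

/-! ## §3 `ω(N) = 4` and `ω(N) = 5`: `40·#S₀(N) < 3·φ(N)`, `s(N) < 3/20 = s(55)` -/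

section FourFive

variable {N : ℕ}

/-- The other prime factors of `N` divide `ℓᵈ − 1` when `N_ℓ` does. [folklore] -/
private theorem mem_erase_primeFactors {ℓ d q : ℕ} (h5 : ∀ ℓ ∈ N.primeFactors, 5 ≤ ℓ) (hℓ : ℓ ∈ N.primeFactors)
    (hdvd : ordCompl[ℓ] N ∣ ℓ ^ d - 1) (hq : q ∈ N.primeFactors.erase ℓ) : q.Prime ∧ 5 ≤ q ∧ q ∣ ℓ ^ d - 1 := by
  have hℓp : ℓ.Prime := Nat.prime_of_mem_primeFactors hℓ
  obtain ⟨hqℓ, hqN⟩ := Finset.mem_erase.1 hq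
  have hqp : q.Prime := Nat.prime_of_mem_primeFactors hqN
  refine ⟨hqp, h5 q hqN, dvd_trans (Nat.dvd_ordCompl_of_dvd_not_dvd (Nat.dvd_of_mem_primeFactors hqN) ?_) hdvd⟩
  intro h
  exact hqℓ ((Nat.prime_dvd_prime_iff_eq hℓp hqp).1 h).symm

/-- The weighted criterion's hypothesis with `c = 28` at four-prime levels. [cite: KoblitzRohrlich1978, §2 Proposition, Case 3 (pp. 1191–1192)] -/
private theorem criterion_four_primes (hcard : N.primeFactors.card = 4) (h5 : ∀ ℓ ∈ N.primeFactors, 5 ≤ ℓ) :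
    ∀ ℓ ∈ N.primeFactors, ∀ d : ℕ, 0 < d → ordCompl[ℓ] N ∣ ℓ ^ d - 1 → 28 ≤ (ℓ - 1) * d := by
  classical
  intro ℓ hℓ d hd hdvd
  have hℓp : ℓ.Prime := Nat.prime_of_mem_primeFactors hℓ
  have h3 : (N.primeFactors.erase ℓ).card = 3 := by rw [Finset.card_erase_of_mem hℓ, hcard]
  obtain ⟨q₁, q₂, q₃, h₁₂, h₁₃, h₂₃, he⟩ := Finset.card_eq_three.1 h3
  have m₁ : q₁ ∈ N.primeFactors.erase ℓ := by rw [he]; simp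
  have m₂ : q₂ ∈ N.primeFactors.erase ℓ := by rw [he]; simp
  have m₃ : q₃ ∈ N.primeFactors.erase ℓ := by rw [he]; simp
  obtain ⟨p₁, f₁, e₁⟩ := mem_erase_primeFactors h5 hℓ hdvd m₁
  obtain ⟨p₂, f₂, e₂⟩ := mem_erase_primeFactors h5 hℓ hdvd m₂
  obtain ⟨p₃, f₃, e₃⟩ := mem_erase_primeFactors h5 hℓ hdvd m₃
  exact twentyeight_le_sub_one_mul_of_three_primes_dvd hℓp (h5 ℓ hℓ) hd p₁ p₂ p₃ f₁ f₂ f₃ h₁₂ h₁₃ h₂₃ e₁ e₂ e₃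

/-- The weighted criterion's hypothesis with `c = 36` at five-prime levels. [cite: KoblitzRohrlich1978, §2 Proposition, Case 4 (pp. 1191–1192)] -/
private theorem criterion_five_primes' (hcard : N.primeFactors.card = 5) (h5 : ∀ ℓ ∈ N.primeFactors, 5 ≤ ℓ) :
    ∀ ℓ ∈ N.primeFactors, ∀ d : ℕ, 0 < d → ordCompl[ℓ] N ∣ ℓ ^ d - 1 → 36 ≤ (ℓ - 1) * d := by
  classical
  intro ℓ hℓ d hd hdvd
  have hℓp : ℓ.Prime := Nat.prime_of_mem_primeFactors hℓ
  have h4 : (N.primeFactors.erase ℓ).card = 4 := by rw [Finset.card_erase_of_mem hℓ, hcard]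
  obtain ⟨q₄, m₄⟩ : (N.primeFactors.erase ℓ).Nonempty := by
    rw [← Finset.card_pos, h4]
    norm_num
  have h3 : ((N.primeFactors.erase ℓ).erase q₄).card = 3 := by rw [Finset.card_erase_of_mem m₄, h4]
  obtain ⟨q₁, q₂, q₃, h₁₂, h₁₃, h₂₃, he⟩ := Finset.card_eq_three.1 h3
  have m₁ : q₁ ∈ (N.primeFactors.erase ℓ).erase q₄ := by rw [he]; simp
  have m₂ : q₂ ∈ (N.primeFactors.erase ℓ).erase q₄ := by rw [he]; simp
  have m₃ : q₃ ∈ (N.primeFactors.erase ℓ).erase q₄ := by rw [he]; simp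
  obtain ⟨h₁₄, m₁'⟩ := Finset.mem_erase.1 m₁
  obtain ⟨h₂₄, m₂'⟩ := Finset.mem_erase.1 m₂
  obtain ⟨h₃₄, m₃'⟩ := Finset.mem_erase.1 m₃
  obtain ⟨p₁, f₁, e₁⟩ := mem_erase_primeFactors h5 hℓ hdvd m₁'
  obtain ⟨p₂, f₂, e₂⟩ := mem_erase_primeFactors h5 hℓ hdvd m₂'
  obtain ⟨p₃, f₃, e₃⟩ := mem_erase_primeFactors h5 hℓ hdvd m₃'
  obtain ⟨p₄, f₄, e₄⟩ := mem_erase_primeFactors h5 hℓ hdvd m₄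
  exact thirtysix_le_sub_one_mul_of_four_primes_dvd hℓp (h5 ℓ hℓ) hd p₁ p₂ p₃ p₄ f₁ f₂ f₃ f₄ h₁₂ h₁₃ h₂₃ h₁₄ h₂₄ h₃₄
    e₁ e₂ e₃ e₄

/-- **REMARK 1 at four-prime levels**: if `N` has exactly four prime factors, all `≥ 5`, then `40·#S₀(N) < 3·φ(N)` (`s(N) ≤ 4/28 < 3/20`).
[cite: KoblitzRohrlich1978, §2 Remark 1 (p. 1192) and Proposition, Case 3 (pp. 1191–1192)] -/
theorem forty_mul_card_bad_lt_four_primes [NeZero N] (hcard : N.primeFactors.card = 4) (h5 : ∀ ℓ ∈ N.primeFactors, 5 ≤ ℓ) :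
    40 * Nat.card {χ : DirichletCharacter ℂ N // χ.Odd ∧ bernoulliOneChar χ = 0} < 3 * N.totient :=
  lt_of_le_of_lt (Nat.mul_le_mul_left _ card_odd_bernoulliOneChar_eq_zero_le)
    (forty_mul_sum_card_lt_of_forall_le (NeZero.ne N) (by rw [hcard]; norm_num) (criterion_four_primes hcard h5))

/-- **REMARK 1 at five-prime levels**: if `N` has exactly five prime factors, all `≥ 5`, then `40·#S₀(N) < 3·φ(N)` (`s(N) ≤ 5/36 < 3/20`).
[cite: KoblitzRohrlich1978, §2 Remark 1 (p. 1192) and Proposition, Case 4 (pp. 1191–1192)] -/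
theorem forty_mul_card_bad_lt_five_primes [NeZero N] (hcard : N.primeFactors.card = 5) (h5 : ∀ ℓ ∈ N.primeFactors, 5 ≤ ℓ) :
    40 * Nat.card {χ : DirichletCharacter ℂ N // χ.Odd ∧ bernoulliOneChar χ = 0} < 3 * N.totient :=
  lt_of_le_of_lt (Nat.mul_le_mul_left _ card_odd_bernoulliOneChar_eq_zero_le)
    (forty_mul_sum_card_lt_of_forall_le (NeZero.ne N) (by rw [hcard]; norm_num) (criterion_five_primes' hcard h5))

/-- A level with a prime factor `≥ 5` exceeds `2`. [folklore] -/
private theorem two_lt_of_primeFactors [NeZero N] (hne : N.primeFactors.Nonempty) (h5 : ∀ ℓ ∈ N.primeFactors, 5 ≤ ℓ) : 2 < N := by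
  obtain ⟨ℓ, hℓ⟩ := hne
  have hle : ℓ ≤ N := Nat.le_of_dvd (NeZero.pos N) (Nat.dvd_of_mem_primeFactors hℓ)
  have := h5 ℓ hℓ
  omega

/-- From `40·#S₀(N) < 3·φ(N)` to `s(N) < 3/20` in `ℚ` (`#S(N) = φ(N)/2`). [cite: KoblitzRohrlich1978, §2 Remark 1 (p. 1192)] -/
private theorem s_lt_of_forty_mul_lt [NeZero N] (hN2 : 2 < N)
    (h : 40 * Nat.card {χ : DirichletCharacter ℂ N // χ.Odd ∧ bernoulliOneChar χ = 0} < 3 * N.totient) :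
    (Nat.card {χ : DirichletCharacter ℂ N // χ.Odd ∧ bernoulliOneChar χ = 0} : ℚ) /
        Nat.card {χ : DirichletCharacter ℂ N // χ.Odd} < 3 / 20 := by
  have hS := two_mul_card_odd_eq_totient' (M := N) hN2
  have hSpos : 0 < Nat.card {χ : DirichletCharacter ℂ N // χ.Odd} := by
    have := Nat.totient_pos.2 (NeZero.pos N)
    omega
  rw [div_lt_div_iff₀ (by exact_mod_cast hSpos) (by norm_num)]
  have h' : (40 : ℚ) * Nat.card {χ : DirichletCharacter ℂ N // χ.Odd ∧ bernoulliOneChar χ = 0} <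
      3 * (2 * Nat.card {χ : DirichletCharacter ℂ N // χ.Odd}) := by
    rw [show (3 : ℚ) * (2 * Nat.card {χ : DirichletCharacter ℂ N // χ.Odd}) = 3 * ((2 * Nat.card {χ : DirichletCharacter ℂ N // χ.Odd} : ℕ) : ℚ)
      by push_cast; ring, hS]
    exact_mod_cast h
  linarith

/-- **`s(N) < 3/20` at four-prime levels** (all prime factors `≥ 5`). [cite: KoblitzRohrlich1978, §2 Remark 1 (p. 1192)] -/
theorem s_lt_three_div_twenty_four_primes [NeZero N] (hcard : N.primeFactors.card = 4) (h5 : ∀ ℓ ∈ N.primeFactors, 5 ≤ ℓ) :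
    (Nat.card {χ : DirichletCharacter ℂ N // χ.Odd ∧ bernoulliOneChar χ = 0} : ℚ) /
        Nat.card {χ : DirichletCharacter ℂ N // χ.Odd} < 3 / 20 :=
  s_lt_of_forty_mul_lt (two_lt_of_primeFactors (by rw [← Finset.card_pos, hcard]; norm_num) h5)
    (forty_mul_card_bad_lt_four_primes hcard h5)

/-- **`s(N) < 3/20` at five-prime levels** (all prime factors `≥ 5`). [cite: KoblitzRohrlich1978, §2 Remark 1 (p. 1192)] -/
theorem s_lt_three_div_twenty_five_primes [NeZero N] (hcard : N.primeFactors.card = 5) (h5 : ∀ ℓ ∈ N.primeFactors, 5 ≤ ℓ) :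
    (Nat.card {χ : DirichletCharacter ℂ N // χ.Odd ∧ bernoulliOneChar χ = 0} : ℚ) /
        Nat.card {χ : DirichletCharacter ℂ N // χ.Odd} < 3 / 20 :=
  s_lt_of_forty_mul_lt (two_lt_of_primeFactors (by rw [← Finset.card_pos, hcard]; norm_num) h5)
    (forty_mul_card_bad_lt_five_primes hcard h5)

/-- **`s(N) < s(55)` at levels with four or five prime factors `≥ 5`**: Remark 1's maximum `3/20` is not attained there.
[cite: KoblitzRohrlich1978, §2 Remark 1 (p. 1192)] -/
theorem s_lt_s_fiftyFive_fourFivePrimes [NeZero N] (hm : N.primeFactors.card = 4 ∨ N.primeFactors.card = 5)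
    (h5 : ∀ ℓ ∈ N.primeFactors, 5 ≤ ℓ) :
    (Nat.card {χ : DirichletCharacter ℂ N // χ.Odd ∧ bernoulliOneChar χ = 0} : ℚ) /
        Nat.card {χ : DirichletCharacter ℂ N // χ.Odd} <
      (Nat.card {χ : DirichletCharacter ℂ 55 // χ.Odd ∧ bernoulliOneChar χ = 0} : ℚ) /
        Nat.card {χ : DirichletCharacter ℂ 55 // χ.Odd} := by
  rw [s_fiftyFive]
  rcases hm with h4 | h5'
  · exact s_lt_three_div_twenty_four_primes h4 h5
  · exact s_lt_three_div_twenty_five_primes h5' h5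

end FourFive

end CyclotomicFermatCMType

end Literature.AlgebraicGeometry.ComplexMultiplication
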